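import Summits.Schanuel.Schanuel.Theorems.RootDecomp1KB3LogBarrier01

/-!
# RootDecomp1KB3LogBarrier — lens 6, generation 25 «THE RESIDUAL IS THE LOG BARRIER: B₃ = PolyDiophantineSchanuel (stmt-Schanuel-31987) ⊢ Literature.Barriers.Schanuel.AlgIndepLogarithms» (CLAIM L2309, PRICE + CHECKLIST G29-α L2310 (strength certificate), NODE L2324; critic VERDICT pending at staging — filed only on GO) — continuation (RootDecomp1KB3LogBarrier02): §2 no Liouville coordinates in spans of logs

(lens-6 g25 HOME kernel K = HOME/decomp-schanuel-lens-6/g25/B3LogBarrier.lean e91b3d3e…, 663 l, imports Theses.RootDecomp1K + Literature BakerLinearFormsQuantitativeProofs + Barriers AlgebraicIndependenceOfLogarithmsProofs + NesterenkoModularScope; P/C + NODE-g25.md. STRENGTH CERTIFICATE, rung 0, no ∀-item moves: the route's declared RESIDUAL B₃ = `PolyDiophantineSchanuel` implies the logarithm barrier's conjecture `AlgIndepLogarithms` (Baker 1975 Thm 3.1 `baker1975_thm_3_1_holds` BY NAME, load-bearing). Port by census-1 gen 19 as `RootDecomp1KB3LogBarrier01–03`: 01 = §0 integer witnesses (`hgt`,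 `wit_int`, `wit_rat`) + §1 Baker's Thm 3.1 as a polynomial linear-independence measure for logarithms (`polyMeasure_of_logs`, `polyDioph_of_logs`); 02 = §2 no Liouville coordinates in the ℚ-span of logarithms of algebraic numbers (`wit_twist`, `not_liouville_of_logForm`, `not_liouville_coord_of_logs`, …); 03 = §3 `b3_hypotheses_of_logs`, `algIndepLogarithms_of_polyDiophantineSchanuel`, §4 corollaries by name (`schanuel_at_logs_…`, `algebraicIndependent_piI_log_two_…`, `transcendental_exp_pi_sq_…`, `threeLogarithmsConjecture_…`), §5 B₃ at z = (1, πi) (`two_le_trdeg_one_piI_…`, `expOnePiAlgebraicIndependent_of_polyDiophantineSchanuel`), §6 placement (`not_hyperLiouville_of_polyMeasure`, `logs_placement`, `cells_vacuous_at_logs`), §7 `algIndepLogarithms_of_strictDiophantineSchanuel`.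
PORT EDITS: linter option dropped; twelve generic helpers private (isAlgebraic_conj/norm/cexp_re/cexp_im, not_liouville_pi, not_liouville_rat_mul_pi, two_le_one_add_sum, cast_one_add_sum, one_div_pow_ceil_le, pow_le_exp_pow_succ, abs_coeff_le_hgt, linForm_ne_zero_of_linearIndependent — dedup-safety) with per-part private copies; two docstrings added; statements and proofs verbatim. `--supports stmt-Schanuel-31987` (the residual item) unless the verdict names another; no census credit carried; rung 0 — nothing here proves Schanuel; B₃ stays OPEN.)
-/

noncomputable section

open Complex Polynomial IntermediateField Finset
open scoped BigOperators

namespace Summit.Schanuel.Schanuel.Theorems.RootDecomp1KB3LogBarrier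

open Literature.NumberTheory.Transcendental (baker1975_thm_3_1 baker1975_thm_3_1_holds)
open Literature.Barriers.Schanuel (AlgIndepLogarithms algebraicIndependent_of_le_trdeg_adjoin
  trdeg_adjoin_union_eq_of_isAlgebraic linearIndependent_one_piI isAlgebraic_I algebraicIndependent_real_of_complex)
open Summit.Schanuel.Schanuel.Theses.RootDecomp1K (PolyDiophantineSchanuel CoordLiouvilleSchanuel
  HyperLiouvilleSchanuel FiniteOrderLiouvilleSchanuel LinLiouvilleSchanuel StrictDiophantineSchanuel)

/-- An algebraic complex number has a non-zero integer polynomial annihilator. -/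
private theorem exists_intPoly_of_isAlgebraic {x : ℂ} (hx : IsAlgebraic ℚ x) :
    ∃ P : ℤ[X], P ≠ 0 ∧ aeval x P = 0 :=
  (IsFractionRing.isAlgebraic_iff ℤ ℚ ℂ).mpr hx

/-! ### §2  No Liouville coordinates in the `ℚ`-span of logarithms of algebraic numbers -/

/-- The quadratic witness for `−(a/b)·γ` when `γ² = ε ∈ {1, −1}`: `b²X² − ε a²`. -/
theorem wit_twist (γ : ℂ) (ε : ℤ) (hε : ε = 1 ∨ ε = -1) (hγ : γ ^ 2 = (ε : ℂ)) (a b : ℤ) (hb : b ≠ 0)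
    {B d : ℕ} (hd : 2 ≤ d) (hBa : a.natAbs ^ 2 ≤ B) (hBb : b.natAbs ^ 2 ≤ B) :
    ∃ Q : ℤ[X], Q ≠ 0 ∧ Q.natDegree ≤ d ∧ (∀ k, |Q.coeff k| ≤ (B : ℤ)) ∧
      aeval (-((a : ℂ) / b) * γ) Q = 0 := by
  refine ⟨C (b ^ 2) * X ^ 2 - C (ε * a ^ 2), ?_, ?_, ?_, ?_⟩
  · intro h
    have h1 : (C (b ^ 2) * X ^ 2 - C (ε * a ^ 2)).coeff 2 = (0 : ℤ[X]).coeff 2 := by rw [h]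
    rw [coeff_sub, coeff_C_mul, coeff_X_pow, if_pos rfl, mul_one, coeff_C, if_neg two_ne_zero,
      sub_zero, coeff_zero] at h1
    exact hb (pow_eq_zero_iff (two_ne_zero) |>.mp h1)
  · refine (natDegree_sub_le _ _).trans ?_
    rw [natDegree_C, Nat.max_zero]
    exact (natDegree_C_mul_X_pow_le _ _).trans hd
  · intro k
    simp only [coeff_sub, coeff_C_mul, coeff_X_pow, coeff_C]
    have ha2 : ((a ^ 2 : ℤ)) ≤ B := by
      have : ((a.natAbs ^ 2 : ℕ) : ℤ) ≤ B := by exact_mod_cast hBa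
      simpa [Int.natAbs_sq] using this
    have hb2 : ((b ^ 2 : ℤ)) ≤ B := by
      have : ((b.natAbs ^ 2 : ℕ) : ℤ) ≤ B := by exact_mod_cast hBb
      simpa [Int.natAbs_sq] using this
    have ha0 : 0 ≤ a ^ 2 := sq_nonneg a
    have hb0 : 0 ≤ b ^ 2 := sq_nonneg b
    rcases hε with rfl | rfl <;> split_ifs <;> simp_all
  · have hbC : (b : ℂ) ≠ 0 := by exact_mod_cast hb
    simp only [map_sub, map_mul, aeval_C, aeval_X, algebraMap_int_eq, Int.coe_castRingHom, map_pow]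
    rw [mul_pow, hγ, sub_eq_zero]
    field_simp

/-- **Core lemma.** If `x·γ` (`x` real, `γ ∈ {1, i}`-like: `‖γ‖ = 1`, `γ² = ±1`) is a `ℚ`-linear
form in logarithms of algebraic numbers, then `x` is not a Liouville number (Baker 1975 Thm 3.1
against Liouville's approximations, with `β₀ = −(a/b)γ`). -/
theorem not_liouville_of_logForm {n : ℕ} (l : Fin n → ℂ) (halg : ∀ i, IsAlgebraic ℚ (cexp (l i)))
    (c : Fin n → ℚ) (x : ℝ) (γ : ℂ) (hγ1 : ‖γ‖ = 1) (ε : ℤ) (hε : ε = 1 ∨ ε = -1)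
    (hγ2 : γ ^ 2 = (ε : ℂ)) (hx : (x : ℂ) * γ = ∑ j, (c j : ℂ) * l j) : ¬ Liouville x := by
  classical
  intro hL
  obtain ⟨d, A, hd2, hwit⟩ := exists_common_witness (fun i => cexp (l i)) halg
  obtain ⟨C, hC, hmain⟩ := baker1975_thm_3_1_holds n d A (fun i => cexp (l i)) l
    (fun i => Complex.exp_ne_zero _) (fun _ => rfl) hwit
  -- the constants
  set Hc : ℕ := ∑ j, ((c j).num.natAbs + (c j).den) with hHc
  set Xn : ℕ := ⌈|x|⌉₊ + 2 with hXn
  set K : ℕ := (Hc + 2) * Xn ^ 2 with hK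
  have hK2 : 2 ≤ K := by
    have h4 : 1 ≤ Xn ^ 2 := Nat.one_le_pow _ _ (by omega)
    calc 2 ≤ (Hc + 2) * 1 := by omega
      _ ≤ (Hc + 2) * Xn ^ 2 := Nat.mul_le_mul_left _ h4
  obtain ⟨m₀, hm₀⟩ := pow_unbounded_of_one_lt ((K : ℝ) ^ C) (one_lt_two (α := ℝ))
  set m : ℕ := m₀ + 2 * ⌈C⌉₊ with hm
  obtain ⟨a, b, hb1, hxne, hlt⟩ := hL m
  have hb0 : b ≠ 0 := by omega
  have hbpos : (0 : ℝ) < b := by exact_mod_cast (show 0 < b by omega)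
  have hb1r : (1 : ℝ) ≤ b := by exact_mod_cast (show 1 ≤ b by omega)
  have hb2r : (2 : ℝ) ≤ b := by exact_mod_cast (show 2 ≤ b by omega)
  -- |a| ≤ Xn · b
  have hsmall : |x - a / b| < 1 := by
    refine hlt.trans_le ?_
    rw [div_le_one (pow_pos hbpos _)]
    exact one_le_pow₀ hb1r
  have haXb : (a.natAbs : ℝ) ≤ Xn * b := by
    have h1 : |(a : ℝ) / b| ≤ |x| + 1 := by
      have := abs_sub_abs_le_abs_sub ((a : ℝ) / b) x
      rw [abs_sub_comm] at this
      linarith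
    have h2 : |(a : ℝ)| ≤ (|x| + 1) * b := by
      rw [abs_div, abs_of_pos hbpos, div_le_iff₀ hbpos] at h1
      exact h1
    have h3 : |x| + 1 ≤ Xn := by
      rw [hXn]; push_cast; linarith [Nat.le_ceil |x|]
    rw [Nat.cast_natAbs, Int.cast_abs]
    exact h2.trans (mul_le_mul_of_nonneg_right h3 hbpos.le)
  -- the level
  set Bn : ℕ := K * b.natAbs ^ 2 with hBn
  have hbabs : 2 ≤ b.natAbs := by omega
  have hX1 : 1 ≤ Xn ^ 2 := Nat.one_le_pow _ _ (by omega)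
  have hb1n : 1 ≤ b.natAbs ^ 2 := Nat.one_le_pow _ _ (by omega)
  have hKB : K ≤ Bn := by
    calc K = K * 1 := (mul_one K).symm
      _ ≤ K * b.natAbs ^ 2 := Nat.mul_le_mul_left _ hb1n
  have hB2 : 2 ≤ Bn := hK2.trans hKB
  have hBa : a.natAbs ^ 2 ≤ Bn := by
    have h1 : (a.natAbs : ℝ) ^ 2 ≤ (Xn : ℝ) ^ 2 * (b.natAbs : ℝ) ^ 2 := by
      rw [← mul_pow]
      have hb' : (b.natAbs : ℝ) = b := by
        rw [Nat.cast_natAbs, Int.cast_abs, abs_of_pos hbpos]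
      rw [hb']
      exact pow_le_pow_left₀ (Nat.cast_nonneg _) haXb 2
    have h2 : Xn ^ 2 ≤ K := by
      calc Xn ^ 2 = 1 * Xn ^ 2 := (one_mul _).symm
        _ ≤ (Hc + 2) * Xn ^ 2 := Nat.mul_le_mul_right _ (by omega)
    have h3 : (a.natAbs ^ 2 : ℕ) ≤ Xn ^ 2 * b.natAbs ^ 2 := by exact_mod_cast h1
    calc a.natAbs ^ 2 ≤ Xn ^ 2 * b.natAbs ^ 2 := h3
      _ ≤ K * b.natAbs ^ 2 := Nat.mul_le_mul_right _ h2
  have hBb : b.natAbs ^ 2 ≤ Bn := by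
    calc b.natAbs ^ 2 = 1 * b.natAbs ^ 2 := (one_mul _).symm
      _ ≤ K * b.natAbs ^ 2 := Nat.mul_le_mul_right _ (by omega)
  have hHcB : Hc ≤ Bn := by
    refine le_trans ?_ hKB
    calc Hc ≤ (Hc + 2) * 1 := by omega
      _ ≤ (Hc + 2) * Xn ^ 2 := Nat.mul_le_mul_left _ hX1
  -- the coefficients β = (−(a/b)γ, c₁, …, c_n)
  let β : Fin (n + 1) → ℂ := Fin.cons (-((a : ℂ) / b) * γ) (fun j => (c j : ℂ))
  have hβwit : ∀ j, ∃ Q : ℤ[X], Q ≠ 0 ∧ Q.natDegree ≤ d ∧ (∀ k, |Q.coeff k| ≤ (Bn : ℤ)) ∧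
      aeval (β j) Q = 0 := by
    intro j
    refine Fin.cases ?_ (fun i => ?_) j
    · simpa [β] using wit_twist γ ε hε hγ2 a b hb0 hd2 hBa hBb
    · simp only [β, Fin.cons_succ]
      refine wit_rat (c i) hd2 (le_trans ?_ hHcB)
      have := single_le_sum (f := fun j => (c j).num.natAbs + (c j).den) (fun _ _ => Nat.zero_le _)
        (mem_univ i)
      simpa [hHc] using this
  have hres := hmain Bn hB2 β hβwit
  have hΛ : β 0 + ∑ i : Fin n, β i.succ * l i = ((x - a / b : ℝ) : ℂ) * γ := by
    simp only [β, Fin.cons_zero, Fin.cons_succ]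
    rw [← hx]
    push_cast
    ring
  rw [hΛ] at hres
  have hγ0 : γ ≠ 0 := by
    intro h; rw [h, norm_zero] at hγ1; exact zero_ne_one hγ1
  rcases hres with h0 | hlt2
  · rcases mul_eq_zero.mp h0 with h1 | h1
    · apply hxne
      have : (x - a / b : ℝ) = 0 := by exact_mod_cast h1
      linarith
    · exact hγ0 h1
  · rw [norm_mul, hγ1, mul_one, Complex.norm_real, Real.norm_eq_abs] at hlt2
    -- `Bn^{-C} ≥ 1/b^m`, contradiction with Liouville
    have hKpos : (0 : ℝ) < K := by positivity
    have hBnr : (Bn : ℝ) = K * (b : ℝ) ^ 2 := by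
      rw [hBn]; push_cast; rw [Nat.cast_natAbs, Int.cast_abs, sq_abs]
    have hBpos : (0 : ℝ) < Bn := by positivity
    have key : (Bn : ℝ) ^ C ≤ (b : ℝ) ^ m := by
      rw [hBnr, Real.mul_rpow hKpos.le (by positivity)]
      have h1 : ((b : ℝ) ^ 2) ^ C = (b : ℝ) ^ (2 * C) := by
        rw [Real.rpow_mul hbpos.le]; norm_num
      rw [h1]
      have h2 : (K : ℝ) ^ C ≤ (b : ℝ) ^ m₀ :=
        hm₀.le.trans (pow_le_pow_left₀ (by norm_num) hb2r m₀)
      have h3 : (b : ℝ) ^ (2 * C) ≤ (b : ℝ) ^ (2 * ⌈C⌉₊) := by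
        rw [show ((b : ℝ) ^ (2 * ⌈C⌉₊) : ℝ) = (b : ℝ) ^ ((2 * ⌈C⌉₊ : ℕ) : ℝ) by
          rw [Real.rpow_natCast]]
        refine Real.rpow_le_rpow_of_exponent_le hb1r ?_
        push_cast
        linarith [Nat.le_ceil C]
      calc (K : ℝ) ^ C * (b : ℝ) ^ (2 * C) ≤ (b : ℝ) ^ m₀ * (b : ℝ) ^ (2 * ⌈C⌉₊) :=
            mul_le_mul h2 h3 (by positivity) (by positivity)
        _ = (b : ℝ) ^ m := by rw [← pow_add]
    have h4 : (Bn : ℝ) ^ (-C) = 1 / (Bn : ℝ) ^ C := by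
      rw [Real.rpow_neg hBpos.le, one_div]
    have h5 : 1 / (b : ℝ) ^ m ≤ (Bn : ℝ) ^ (-C) := by
      rw [h4]
      exact one_div_le_one_div_of_le (Real.rpow_pos_of_pos hBpos C) key
    linarith

/-- `γ = 1`. -/
theorem not_liouville_of_logForm_one {n : ℕ} (l : Fin n → ℂ) (halg : ∀ i, IsAlgebraic ℚ (cexp (l i)))
    (c : Fin n → ℚ) (x : ℝ) (hx : (x : ℂ) = ∑ j, (c j : ℂ) * l j) : ¬ Liouville x :=
  not_liouville_of_logForm l halg c x 1 (by simp) 1 (Or.inl rfl) (by simp) (by simpa using hx)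

/-- `γ = i`. -/
theorem not_liouville_of_logForm_I {n : ℕ} (l : Fin n → ℂ) (halg : ∀ i, IsAlgebraic ℚ (cexp (l i)))
    (c : Fin n → ℚ) (x : ℝ) (hx : (x : ℂ) * I = ∑ j, (c j : ℂ) * l j) : ¬ Liouville x :=
  not_liouville_of_logForm l halg c x I (by simp) (-1) (Or.inr rfl) (by simp) hx

/-- The complex conjugate of an algebraic number is algebraic. -/
private theorem isAlgebraic_conj {α : ℂ} (h : IsAlgebraic ℚ α) : IsAlgebraic ℚ (starRingEnd ℂ α) := by
  obtain ⟨P, hP0, hP⟩ := exists_intPoly_of_isAlgebraic h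
  refine (IsFractionRing.isAlgebraic_iff ℤ ℚ ℂ).mp ⟨P, hP0, ?_⟩
  have h1 := Polynomial.aeval_algHom_apply ((starRingEnd ℂ).toIntAlgHom) α P
  rw [hP, map_zero] at h1
  exact h1

/-- The absolute value of an algebraic number is algebraic (`|α|² = α ᾱ`). -/
private theorem isAlgebraic_norm {α : ℂ} (h : IsAlgebraic ℚ α) : IsAlgebraic ℚ ((‖α‖ : ℝ) : ℂ) := by
  have h2 : IsAlgebraic ℚ (((‖α‖ : ℝ) : ℂ) ^ 2) := by
    rw [show ((‖α‖ : ℝ) : ℂ) ^ 2 = α * starRingEnd ℂ α by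
      rw [Complex.mul_conj, Complex.normSq_eq_norm_sq]; push_cast; ring]
    exact h.mul (isAlgebraic_conj h)
  exact IsAlgebraic.of_pow (by norm_num) h2

/-- The real parts `Re lⱼ = log |e^{lⱼ}|` are again logarithms of algebraic numbers. -/
private theorem isAlgebraic_cexp_re {l : ℂ} (h : IsAlgebraic ℚ (cexp l)) :
    IsAlgebraic ℚ (cexp ((l.re : ℝ) : ℂ)) := by
  rw [← Complex.ofReal_exp, ← Complex.norm_exp]
  exact isAlgebraic_norm h

/-- … and so are the `i·Im lⱼ` (`e^{i Im l} = e^l / |e^l|`). -/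
private theorem isAlgebraic_cexp_im {l : ℂ} (h : IsAlgebraic ℚ (cexp l)) :
    IsAlgebraic ℚ (cexp (((l.im : ℝ) : ℂ) * I)) := by
  have he : cexp (((l.im : ℝ) : ℂ) * I) = cexp l * (cexp ((l.re : ℝ) : ℂ))⁻¹ := by
    rw [← Complex.exp_neg, ← Complex.exp_add]
    congr 1
    linear_combination Complex.re_add_im l
  rw [he]
  exact h.mul (isAlgebraic_cexp_re h).inv

/-- **No Liouville coordinates.** For a tuple `l` of logarithms of algebraic numbers, no element of
the `ℚ`-span of `l` has a Liouville real or imaginary part. -/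
theorem not_liouville_coord_of_logs {n : ℕ} (l : Fin n → ℂ) (halg : ∀ i, IsAlgebraic ℚ (cexp (l i))) :
    ¬ ∃ w ∈ Submodule.span ℚ (Set.range l), Liouville w.re ∨ Liouville w.im := by
  rintro ⟨w, hw, hLw⟩
  obtain ⟨c, rfl⟩ := (Submodule.mem_span_range_iff_exists_fun ℚ).mp hw
  have hsmul : ∀ j, c j • l j = (c j : ℂ) * l j := fun j => by rw [Rat.smul_def]
  simp only [hsmul] at hLw
  rcases hLw with hre | him
  · -- real part: a form in the logs `Re lⱼ`
    refine not_liouville_of_logForm_one (fun j => ((l j).re : ℂ)) (fun j => isAlgebraic_cexp_re (halg j))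
      c _ ?_ hre
    rw [Complex.re_sum]
    push_cast
    refine sum_congr rfl fun j _ => ?_
    rw [show (c j : ℂ) = ((c j : ℝ) : ℂ) from (Complex.ofReal_ratCast (c j)).symm, Complex.re_ofReal_mul]
    push_cast
    ring
  · -- imaginary part: a form in the logs `i Im lⱼ`
    refine not_liouville_of_logForm_I (fun j => ((l j).im : ℂ) * I) (fun j => isAlgebraic_cexp_im (halg j))
      c _ ?_ him
    rw [Complex.im_sum]
    push_cast
    rw [sum_mul]
    refine sum_congr rfl fun j _ => ?_
    rw [show (c j : ℂ) = ((c j : ℝ) : ℂ) from (Complex.ofReal_ratCast (c j)).symm, Complex.im_ofReal_mul]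
    push_cast
    ring

/-- §2 (b), real part, in the CLAIM's naming (L2309): ONLY the algebraicity of the `e^{lⱼ}` is used — no
`ℚ`-freeness, no `lⱼ ≠ 0`. -/
theorem not_liouville_re_of_mem_span_logs {n : ℕ} (l : Fin n → ℂ) (halg : ∀ i, IsAlgebraic ℚ (cexp (l i)))
    {w : ℂ} (hw : w ∈ Submodule.span ℚ (Set.range l)) : ¬ Liouville w.re :=
  fun h => not_liouville_coord_of_logs l halg ⟨w, hw, Or.inl h⟩

/-- §2 (b), imaginary part (same hypotheses). -/
theorem not_liouville_im_of_mem_span_logs {n : ℕ} (l : Fin n → ℂ) (halg : ∀ i, IsAlgebraic ℚ (cexp (l i)))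
    {w : ℂ} (hw : w ∈ Submodule.span ℚ (Set.range l)) : ¬ Liouville w.im :=
  fun h => not_liouville_coord_of_logs l halg ⟨w, hw, Or.inr h⟩

/-- **`π` is not a Liouville number** — the `n = 1`, `α = −1`, `l = iπ` instance of the core lemma
(`π · i = 1 · (iπ)`); agrees with the tree's `RootDecomp1BNesterenkoRadical.not_liouville_pi` (probe). -/
private theorem not_liouville_pi : ¬ Liouville Real.pi :=
  not_liouville_of_logForm_I ![(Real.pi : ℂ) * I]
    (fun i => by
      fin_cases i
      simp only [Matrix.cons_val_fin_one, Complex.exp_pi_mul_I]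
      exact isAlgebraic_one.neg)
    ![1] Real.pi (by simp only [Fin.sum_univ_one, Matrix.cons_val_fin_one]; push_cast; ring)

/-- … and neither is any non-zero rational multiple `q·π` (the imaginary parts of the span of `(1, πi)`). -/
private theorem not_liouville_rat_mul_pi (q : ℚ) : ¬ Liouville ((q : ℝ) * Real.pi) :=
  not_liouville_of_logForm_I ![(Real.pi : ℂ) * I]
    (fun i => by
      fin_cases i
      simp only [Matrix.cons_val_fin_one, Complex.exp_pi_mul_I]
      exact isAlgebraic_one.neg)
    ![q] ((q : ℝ) * Real.pi) (by simp only [Fin.sum_univ_one, Matrix.cons_val_fin_one]; push_cast; ring)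

end Summit.Schanuel.Schanuel.Theorems.RootDecomp1KB3LogBarrier

end
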